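import Literature.AlgebraicGeometry.Resolution.BlowupAlgebraStrictTransform
import Literature.AlgebraicGeometry.Resolution.BlowupAlgebraPresentation
import Literature.AlgebraicGeometry.Resolution.NodalBlowupChartAlgebra
import Literature.AlgebraicGeometry.Resolution.CharPolyhedronOriginChartMonic
import Mathlib.RingTheory.Localization.Algebra
import Mathlib.RingTheory.Polynomial.ScaleRoots
import Mathlib.RingTheory.AdjoinRoot
import HarnessLib

/-!
# [OURS · L1 W4.2] `Corridor3WLadderCPFramePolynomialChart` — D18 brick (P2b), ring level: the chart of the blow-up of the
# CP-frame hypersurface `R[X]/(h)` along `V(X, u_J)` is `R[I_J/u_{j₀}][X']/(h')`, `h'` the monic transform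

Crux chain w42 (`SigmaMaxModifications`, stmt-ResolutionOfSingularities-18506; conjunct stmt-ResolutionOfSingularities-19249),
object D18 «HYPERSURFACE PROPAGATION + ADAPTED-FRAME EXISTENCE», clause (P2b) «chart identification» of the cut (res-D-pv-050
09:33:13Z). Helper file `--supports stmt-ResolutionOfSingularities-19249 --as helper` (counted 0). OURS; NOT statements of
H. Hironaka's manuscript [Hironaka2017]; AI-written, weaker than expert review.

WHAT. A CP frame presents `𝒪_{X_n,x_n}` by `R[X]/(h)` (`R` regular local with r.s.p. `u`, `h` monic); a permissible centre through
`x_n` reads `V(X, u_J)` in an adapted frame (`IsCPFrameAlong`: `J = {1, 2}`; a closed point: `J = univ`). After (P2a)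
(`…CPFramePullback`, `…CPFramePullbackResidue`: the presentation clauses persist at the points of `Bl ×_{X_n} Spec R[X]/(h)` over
`x_n`, a blow-up of `Spec R[X]/(h)` along `(X̄, ū_J)`), the local rings upstairs are localisations of the affine blowup algebras
`(R[X]/(h))[J̄/ū_{j₀}]` (tree `IsBlowup.exists_blowupAlgebra_stalk_ringEquiv`; near points lie in a `u_{j₀}`-chart, `j₀ ∈ J`, by the
directrix). THIS FILE computes that chart ring, in the tree's image model `blowupAlgebra I a ⊆ R[1/a]` (GW (13.19)):

* `exists_polynomial_ringEquiv_blowupAlgebra` — **`R[I/a][X'] ≅ R[X][(I R[X] + (X))/a]`**, `X' ↦ X/a`, for ANY ideal `I` and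
  element `a` of any commutative ring `R` (the `a`-chart of `Bl_{V(I,X)} 𝔸¹_R` is `𝔸¹` over the `a`-chart of `Bl_I R`);
* `map_comp_C_mul_X_eq` — the transform relation `h'_{m-i} c^i = ψ(h_{m-i})` means `h^ψ(cX') = c^m h'(X')` (`scaleRoots`);
* `exists_monic_transform` — the monic transform `h'` EXISTS on `R[I_J/u_{j₀}]` when `h_{m-i} ∈ I_J^i` (instance of the tree's
  abstract `CossartPiltant.exists_monic_originChart`, p519647);
* `exists_adjoinRoot_ringEquiv_blowupAlgebra` — **`R[I/a][X']/(h') ≅ (R[X]/(h))[J̄/ā]`** for `a` prime in `R[I/a]`, compatible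
  with the structure maps (the strict transform of the hypersurface is cut out by `h'`; tree
  `blowupAlgebra.quotientKerMapQuotientEquiv`, GW Prop. 13.96 (2));
* `prime_algebraMap_blowupAlgebra_of_isRsopPart` — `z_i` is prime in `R[(z)/z_i]` for `z` part of a regular system of
  parameters of a regular local ring (Stacks 0BIQ via tree `blowupAlgebra.isPrime_span_algebraMap`);
* `exists_monic_transform_ringEquiv` — the package: transform + chart isomorphism.

What is NOT here (named for the successor): the LOCAL reading at a near point (`(R[I_J/u_{j₀}][X']/(h'))_𝔔 = R'[X'']/(h'')`
with `R' = R[I_J/u_{j₀}]_𝔮` regular local of dimension `3`, after the translation `X'' = X' - θ` of `…CPFrameTranslate` p521363 —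
needs the near-point/directrix input (P3) `isOnProjDirectrix_of_isNearPoint_of_dirDim_eq_geomDirDim`, p518570) and the scheme
glue with `IsBlowup.exists_blowupAlgebra_stalk_ringEquiv` / `BlowupsFlatBaseChange`.
-/

noncomputable section

set_option linter.dupNamespace false

open Polynomial IsLocalization IsLocalRing
open Literature.AlgebraicGeometry.Resolution

namespace Summit.ResolutionOfSingularities.ResolutionOfSingularities.Theorems.SigmaMaxModificationsCorridor3.Moving

universe u

variable {R : Type u} [CommRing R] (I : Ideal R) (a : R)

/-- `X ∈ I·R[X] + (X)`, the centre ideal of the chart computation. [folklore] -/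
theorem X_mem_map_C_sup_span_X : (X : R[X]) ∈ I.map (C : R →+* R[X]) ⊔ Ideal.span {X} :=
  Ideal.mem_sup_right (Ideal.mem_span_singleton_self X)

/-- [OURS · L1 W4.2] **The `a`-chart of the blow-up of `𝔸¹_R` along `V(I, X)` is `𝔸¹` over the `a`-chart of the
blow-up of `Spec R` along `I`:** `R[I/a][X'] ≅ R[X][(I R[X] + (X))/a]` (affine blowup algebras in the image model
`blowupAlgebra ⊆ R[1/a]` of the tree, GW (13.19)), the isomorphism sending a coefficient `b ∈ R[I/a]` to its image under
the map of blowup algebras along `C : R → R[X]` and the new variable `X'` to the generator `X/a` (so `X ↦ a X'`).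
Surjectivity: the target is generated over `R[X]` by the `y/a`, `y ∈ I R[X] + (X) = (C(I) ∪ {X})`; injectivity: through
`R[1/a][X] ≅ R[X][1/a]` (`Polynomial.isLocalization`), where the map becomes `p ↦ p(a⁻¹ X)` on `R[I/a] ⊆ R[1/a]`. [folklore] -/
theorem exists_polynomial_ringEquiv_blowupAlgebra :
    ∃ e : (blowupAlgebra I a)[X] ≃+*
        blowupAlgebra (I.map (C : R →+* R[X]) ⊔ Ideal.span {X}) (C a),
      (∀ b : blowupAlgebra I a, e (C b) =
        blowupAlgebraMap (C : R →+* R[X]) I (I.map (C : R →+* R[X]) ⊔ Ideal.span {X}) a le_sup_left b) ∧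
      e X = blowupAlgebra.gen (I.map (C : R →+* R[X]) ⊔ Ideal.span {X}) (C a) X (X_mem_map_C_sup_span_X I) := by
  set J₀ : Ideal R[X] := I.map (C : R →+* R[X]) ⊔ Ideal.span {X} with hJ₀
  let φ₀ : blowupAlgebra I a →+* blowupAlgebra J₀ (C a) :=
    blowupAlgebraMap (C : R →+* R[X]) I J₀ a le_sup_left
  let Φ : (blowupAlgebra I a)[X] →+* blowupAlgebra J₀ (C a) :=
    eval₂RingHom φ₀ (blowupAlgebra.gen J₀ (C a) X (X_mem_map_C_sup_span_X I))
  -- the structure map `ρ : R[X] → R[I/a][X']`, `X ↦ a X'`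
  let ρ : R[X] →+* (blowupAlgebra I a)[X] :=
    eval₂RingHom (C.comp (algebraMap R (blowupAlgebra I a))) (C (algebraMap R (blowupAlgebra I a) a) * X)
  have hΦC : ∀ b, Φ (C b) = φ₀ b := fun b => eval₂_C _ _
  have hΦX : Φ X = blowupAlgebra.gen J₀ (C a) X (X_mem_map_C_sup_span_X I) := eval₂_X _ _
  have hΦρ' : Φ.comp ρ = algebraMap R[X] (blowupAlgebra J₀ (C a)) := by
    refine Polynomial.ringHom_ext (fun r => ?_) ?_
    · rw [RingHom.comp_apply]
      simp only [ρ, coe_eval₂RingHom, eval₂_C, RingHom.comp_apply]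
      rw [hΦC, blowupAlgebraMap_algebraMap]
    · rw [RingHom.comp_apply]
      simp only [ρ, coe_eval₂RingHom, eval₂_X]
      rw [map_mul, hΦC, hΦX, blowupAlgebraMap_algebraMap, blowupAlgebra.algebraMap_mul_gen]
  have hΦρ : ∀ g : R[X], Φ (ρ g) = algebraMap R[X] (blowupAlgebra J₀ (C a)) g := fun g =>
    congrFun (congrArg DFunLike.coe hΦρ') g
  -- surjectivity
  have hsurj : Function.Surjective Φ := by
    intro z
    obtain ⟨z, hz⟩ := z
    suffices h : ∀ w : Localization.Away (C a), w ∈ blowupAlgebra J₀ (C a) →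
        ∃ p, (Φ p : Localization.Away (C a)) = w by
      obtain ⟨p, hp⟩ := h z hz
      exact ⟨p, Subtype.ext hp⟩
    intro w hw
    induction hw using Algebra.adjoin_induction with
    | mem x hx =>
      obtain ⟨y, hy, rfl⟩ := hx
      -- `y ∈ I R[X] + (X)`: span induction on the generators `C '' I ∪ {X}`
      have hy' : y ∈ Ideal.span ((C : R →+* R[X]) '' (I : Set R) ∪ {X}) := by
        rw [Ideal.span_union]
        exact hy
      refine Submodule.span_induction (p := fun y _ => ∃ p, (Φ p : Localization.Away (C a)) =
          algebraMap R[X] (Localization.Away (C a)) y * Away.invSelf (C a)) ?_ ?_ ?_ ?_ hy'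
      · rintro t (⟨s, hs, rfl⟩ | ht)
        · refine ⟨C (blowupAlgebra.gen I a s hs), ?_⟩
          rw [hΦC]
          change (blowupAlgebraMap (C : R →+* R[X]) I J₀ a le_sup_left (blowupAlgebra.gen I a s hs) : Localization.Away (C a)) = _
          rw [blowupAlgebraMap_gen]
          rfl
        · rw [Set.mem_singleton_iff] at ht
          subst ht
          exact ⟨X, by rw [hΦX]; rfl⟩
      · exact ⟨0, by simp⟩
      · rintro x y - - ⟨p, hp⟩ ⟨q, hq⟩
        exact ⟨p + q, by rw [map_add, Subalgebra.coe_add, hp, hq, map_add, add_mul]⟩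
      · rintro g x - ⟨p, hp⟩
        refine ⟨ρ g * p, ?_⟩
        rw [map_mul, Subalgebra.coe_mul, hp, hΦρ, smul_eq_mul, map_mul, mul_assoc]
        rfl
    | algebraMap g => exact ⟨ρ g, by rw [hΦρ]; rfl⟩
    | add x y _ _ hx hy =>
      obtain ⟨p, hp⟩ := hx
      obtain ⟨q, hq⟩ := hy
      exact ⟨p + q, by rw [map_add, Subalgebra.coe_add, hp, hq]⟩
    | mul x y _ _ hx hy =>
      obtain ⟨p, hp⟩ := hx
      obtain ⟨q, hq⟩ := hy
      exact ⟨p * q, by rw [map_mul, Subalgebra.coe_mul, hp, hq]⟩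
  -- injectivity, through `R[1/a][X]`
  have hinj : Function.Injective Φ := by
    let L := Localization.Away a
    letI : Algebra R[X] L[X] := Polynomial.algebra R L
    haveI : IsLocalization.Away (C a : R[X]) L[X] := by
      have h := Polynomial.isLocalization (Submonoid.powers a) L
      rw [Submonoid.map_powers] at h
      exact h
    let T : Localization.Away (C a : R[X]) ≃ₐ[R[X]] L[X] :=
      IsLocalization.algEquiv (Submonoid.powers (C a : R[X])) _ _
    -- `T ∘ awayMap C a = Polynomial.C` on `L`
    have hT1 : (T : Localization.Away (C a : R[X]) →+* L[X]).comp (Localization.awayMap (C : R →+* R[X]) a) =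
        (C : L →+* L[X]) := by
      refine IsLocalization.ringHom_ext (Submonoid.powers a) (RingHom.ext fun r => ?_)
      rw [RingHom.comp_apply, RingHom.comp_apply, awayMap_algebraMap, RingHom.coe_coe, AlgEquiv.commutes,
        Polynomial.algebraMap_def, coe_mapRingHom, map_C, RingHom.comp_apply]
    have hT2 : T (Away.invSelf (C a : R[X])) = C (Away.invSelf a : L) := by
      have h1 : algebraMap R[X] L[X] (C a) * T (Away.invSelf (C a : R[X])) = 1 := by
        rw [← T.commutes, ← map_mul, Away.mul_invSelf, map_one]
      have h2 : algebraMap R[X] L[X] (C a) * C (Away.invSelf a : L) = 1 := by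
        rw [Polynomial.algebraMap_def, coe_mapRingHom, map_C, ← C_mul, Away.mul_invSelf, C_1]
      exact left_inv_eq_right_inv (by rw [mul_comm] at h1; exact h1) h2 ▸ rfl
    -- `T ∘ val ∘ Φ = (map val) then comp (C a⁻¹ X)`
    have hkey : ∀ p : (blowupAlgebra I a)[X],
        T ((Φ p : Localization.Away (C a : R[X]))) = (p.map (blowupAlgebra I a).val.toRingHom).comp
          (C (Away.invSelf a : L) * X) := by
      intro p
      refine Polynomial.induction_on' p (fun p q hp hq => by
        simp only [map_add, Subalgebra.coe_add, hp, hq, Polynomial.map_add, add_comp]) fun n b => ?_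
      rw [← C_mul_X_pow_eq_monomial, map_mul, map_pow, hΦC, hΦX, Subalgebra.coe_mul, Subalgebra.coe_pow,
        coe_blowupAlgebraMap, blowupAlgebra.coe_gen, map_mul, map_pow, map_mul, Polynomial.map_mul,
        Polynomial.map_pow, map_C, map_X, mul_comp, pow_comp, C_comp, X_comp, hT2, AlgEquiv.commutes]
      congr 1
      · exact congrFun (congrArg DFunLike.coe hT1) (b : L)
      · rw [Polynomial.algebraMap_def, coe_mapRingHom, map_X, mul_comm]
    intro p q hpq
    have h1 := congrArg (fun z : blowupAlgebra J₀ (C a) => T (z : Localization.Away (C a : R[X]))) hpq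
    simp only [hkey] at h1
    -- undo the substitution `X ↦ a⁻¹ X`
    have h2 : ∀ s : L[X], (s.comp (C (Away.invSelf a : L) * X)).comp (C (algebraMap R L a) * X) = s := by
      intro s
      rw [comp_assoc, mul_comp, C_comp, X_comp, ← mul_assoc, ← C_mul, mul_comm (Away.invSelf a),
        Away.mul_invSelf, C_1, one_mul, comp_X]
    have h3 := congrArg (fun s : L[X] => s.comp (C (algebraMap R L a) * X)) h1
    simp only [h2] at h3
    exact Polynomial.map_injective _ Subtype.val_injective h3
  refine ⟨RingEquiv.ofBijective Φ ⟨hinj, hsurj⟩, fun b => hΦC b, hΦX⟩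

/-- [OURS · L1 W4.2] **`h(cX') = c^m · h'(X')`** for monic `h`, `h'` of the same degree `m` whose coefficients satisfy the
transform relation `h'_{m-i} c^i = ψ(h_{m-i})` (`1 ≤ i ≤ m`; Cossart–Piltant (2.7), tree `CossartPiltant.exists_monic_originChart`):
indeed `h^ψ = scaleRoots h' c`, and Mathlib's `scaleRoots_eval₂_mul`. [folklore] -/
theorem map_comp_C_mul_X_eq {S : Type u} {S' : Type*} [CommRing S] [CommRing S'] (ψ : S →+* S') (c : S')
    {h : S[X]} (hmon : h.Monic) {h' : S'[X]} (hmon' : h'.Monic) (hdeg : h'.natDegree = h.natDegree)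
    (hcoef : ∀ i ∈ Finset.Icc 1 h.natDegree, h'.coeff (h.natDegree - i) * c ^ i = ψ (h.coeff (h.natDegree - i))) :
    (h.map ψ).comp (C c * X) = C c ^ h.natDegree * h' := by
  have hsc : h.map ψ = scaleRoots h' c := by
    ext k
    rw [coeff_map, coeff_scaleRoots, hdeg]
    rcases lt_trichotomy k h.natDegree with hk | rfl | hk
    · have := hcoef (h.natDegree - k) (Finset.mem_Icc.mpr ⟨by omega, by omega⟩)
      rw [show h.natDegree - (h.natDegree - k) = k by omega] at this
      exact this.symm
    · rw [Nat.sub_self, pow_zero, mul_one, hmon.coeff_natDegree, map_one, ← hdeg, hmon'.coeff_natDegree]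
    · rw [coeff_eq_zero_of_natDegree_lt hk, map_zero, coeff_eq_zero_of_natDegree_lt (hdeg ▸ hk), zero_mul]
  rw [hsc, comp, scaleRoots_eval₂_mul, eval₂_C_X, hdeg]

/-- [OURS · L1 W4.2] **The monic transform `h'(X') = u_{j₀}^{-m} h(u_{j₀} X')` exists on the `j₀`-chart `R[I_J/u_{j₀}]`**
(`I_J = (u_j : j ∈ J)`) as soon as `h_{m-i} ∈ I_J^i` for `1 ≤ i ≤ m` — the instance `ψ = (R → R[I_J/u_{j₀}])`,
`u'_j = u_j/u_{j₀}` (`j ∈ J ∖ j₀`), `u'_j = u_j` otherwise, of the tree's abstract `CossartPiltant.exists_monic_originChart`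
(p519647). [cite: CossartPiltant2019, (2.7) and Prop. 2.6 (arXiv v1 pp. 13–14)] -/
theorem exists_monic_transform {n : ℕ} (u : Fin n → R) {J : Finset (Fin n)} {j₀ : Fin n}
    [Nontrivial (blowupAlgebra (Ideal.span (u '' ↑J)) (u j₀))] {h : R[X]}
    (hI : ∀ i ∈ Finset.Icc 1 h.natDegree, h.coeff (h.natDegree - i) ∈ Ideal.span (u '' ↑J) ^ i) :
    ∃ h' : (blowupAlgebra (Ideal.span (u '' ↑J)) (u j₀))[X], h'.Monic ∧ h'.natDegree = h.natDegree ∧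
      ∀ i ∈ Finset.Icc 1 h.natDegree, h'.coeff (h.natDegree - i) *
        algebraMap R (blowupAlgebra (Ideal.span (u '' ↑J)) (u j₀)) (u j₀) ^ i =
          algebraMap R (blowupAlgebra (Ideal.span (u '' ↑J)) (u j₀)) (h.coeff (h.natDegree - i)) := by
  classical
  set I := Ideal.span (u '' (↑J : Set (Fin n))) with hIdef
  have hmemI : ∀ j ∈ J, u j ∈ I := fun j hj => Ideal.subset_span ⟨j, Finset.mem_coe.mpr hj, rfl⟩
  let u' : Fin n → blowupAlgebra I (u j₀) := fun j =>
    if hj : j ∈ J ∧ j ≠ j₀ then blowupAlgebra.gen I (u j₀) (u j) (hmemI j hj.1)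
    else algebraMap R (blowupAlgebra I (u j₀)) (u j)
  have hj₀' : u' j₀ = algebraMap R (blowupAlgebra I (u j₀)) (u j₀) := by
    simp only [u', ne_eq, not_true_eq_false, and_false, dite_false]
  have hrel : ∀ j, algebraMap R (blowupAlgebra I (u j₀)) (u j) =
      if j ∈ J ∧ j ≠ j₀ then u' j₀ * u' j else u' j := by
    intro j
    by_cases hj : j ∈ J ∧ j ≠ j₀
    · rw [if_pos hj, hj₀']
      simp only [u', dif_pos hj]
      rw [blowupAlgebra.algebraMap_mul_gen]
    · rw [if_neg hj]
      simp only [u', dif_neg hj]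
  obtain ⟨h', hmon', hdeg, hcoef⟩ := CossartPiltant.exists_monic_originChart (algebraMap R (blowupAlgebra I (u j₀))) u u' hrel hI
  refine ⟨h', hmon', hdeg, fun i hi => ?_⟩
  rw [← hj₀']
  exact hcoef i hi

/-- [OURS · L1 W4.2] **The `a`-chart of the blow-up of the hypersurface `R[X]/(h)` along the image of `V(I, X)` is
`R[I/a][X']/(h')`**, `h'` the monic transform: for `h ∈ R[X]` monic of degree `m`, `h' ∈ R[I/a][X']` monic of degree `m` with
`h'_{m-i} a^i = h_{m-i}` (`1 ≤ i ≤ m`), and `a` PRIME in `R[I/a]` (e.g. `I` generated by part of a regular system of parameters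
containing `a`, `prime_algebraMap_blowupAlgebra_of_isRsopPart`), there is a ring isomorphism
`R[I/a][X']/(h') ≅ (R[X]/(h))[J̄/ā]`, `J = I R[X] + (X)`, compatible with the structure maps (`r ↦ r`, `X ↦ a X'`). Proof:
on the polynomial chart (`exists_polynomial_ringEquiv_blowupAlgebra`) `h = a^m · h'` (`map_comp_C_mul_X_eq`), `a` stays prime in
`R[I/a][X']` and does not divide the monic `h'`, so the tree's `blowupAlgebra.quotientKerMapQuotientEquiv` (GW Prop. 13.96 (2):
the chart ring of the blow-up of a hypersurface is the quotient by the strict transform of its equation) applies. The carrier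
`R[I/a][X']/(h')` is spelled `AdjoinRoot h'`. [cite: GortzWedhorn2020, Prop. 13.96 (2) and p. 416] -/
theorem exists_adjoinRoot_ringEquiv_blowupAlgebra {h : R[X]} (hmon : h.Monic) {h' : (blowupAlgebra I a)[X]}
    (hmon' : h'.Monic) (hdeg : h'.natDegree = h.natDegree)
    (hcoef : ∀ i ∈ Finset.Icc 1 h.natDegree, h'.coeff (h.natDegree - i) * algebraMap R (blowupAlgebra I a) a ^ i =
      algebraMap R (blowupAlgebra I a) (h.coeff (h.natDegree - i)))
    (hprime : Prime (algebraMap R (blowupAlgebra I a) a)) :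
    ∃ e : AdjoinRoot h' ≃+*
        blowupAlgebra ((I.map (C : R →+* R[X]) ⊔ Ideal.span {X}).map (Ideal.Quotient.mk (Ideal.span {h})))
          (Ideal.Quotient.mk (Ideal.span {h}) (C a)),
      ∀ g : R[X], e (AdjoinRoot.mk h' (eval₂ (C.comp (algebraMap R (blowupAlgebra I a)))
          (C (algebraMap R (blowupAlgebra I a) a) * X) g)) =
        algebraMap (R[X] ⧸ Ideal.span {h}) _ (Ideal.Quotient.mk _ g) := by
  set J₀ : Ideal R[X] := I.map (C : R →+* R[X]) ⊔ Ideal.span {X} with hJ₀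
  obtain ⟨e₁, he₁C, he₁X⟩ := exists_polynomial_ringEquiv_blowupAlgebra I a
  set a₁ := algebraMap R (blowupAlgebra I a) a with ha₁
  let ρ : R[X] →+* (blowupAlgebra I a)[X] :=
    eval₂RingHom (C.comp (algebraMap R (blowupAlgebra I a))) (C a₁ * X)
  have heρ' : (e₁ : (blowupAlgebra I a)[X] →+* blowupAlgebra J₀ (C a)).comp ρ =
      algebraMap R[X] (blowupAlgebra J₀ (C a)) := by
    refine Polynomial.ringHom_ext (fun r => ?_) ?_
    · rw [RingHom.comp_apply]
      simp only [ρ, coe_eval₂RingHom, eval₂_C, RingHom.comp_apply, RingHom.coe_coe]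
      rw [he₁C, blowupAlgebraMap_algebraMap]
    · rw [RingHom.comp_apply]
      simp only [ρ, coe_eval₂RingHom, eval₂_X, RingHom.coe_coe]
      rw [map_mul, he₁C, he₁X, blowupAlgebraMap_algebraMap, blowupAlgebra.algebraMap_mul_gen]
  have heρ : ∀ g : R[X], e₁ (ρ g) = algebraMap R[X] (blowupAlgebra J₀ (C a)) g := fun g =>
    congrFun (congrArg DFunLike.coe heρ') g
  have he₁a : e₁ (C a₁) = algebraMap R[X] (blowupAlgebra J₀ (C a)) (C a) := by
    rw [he₁C, blowupAlgebraMap_algebraMap]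
  -- the factorisation `h = (C a)^m · e₁ h'` on the chart
  have hρh : ρ h = C a₁ ^ h.natDegree * h' := by
    have := map_comp_C_mul_X_eq (algebraMap R (blowupAlgebra I a)) a₁ hmon hmon' hdeg hcoef
    rw [← this, comp, eval₂_map]
    rfl
  have hf : algebraMap R[X] (blowupAlgebra J₀ (C a)) h =
      algebraMap R[X] (blowupAlgebra J₀ (C a)) (C a) ^ h.natDegree * e₁ h' := by
    rw [← heρ, hρh, map_mul, map_pow, he₁a]
  have hprime' : Prime (algebraMap R[X] (blowupAlgebra J₀ (C a)) (C a)) := by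
    rw [← he₁a, MulEquiv.prime_iff]
    exact Polynomial.prime_C_iff.mpr hprime
  have hndvd : ¬ algebraMap R[X] (blowupAlgebra J₀ (C a)) (C a) ∣ e₁ h' := by
    rw [← he₁a]
    intro hd
    have hd' : C a₁ ∣ h' := by
      have := map_dvd e₁.symm hd
      rwa [RingEquiv.symm_apply_apply, RingEquiv.symm_apply_apply] at this
    have h1 := (C_dvd_iff_dvd_coeff a₁ h').mp hd' h'.natDegree
    rw [hmon'.coeff_natDegree] at h1
    exact hprime.not_unit (isUnit_of_dvd_one h1)
  let E₀ : AdjoinRoot h' ≃+* (blowupAlgebra J₀ (C a) ⧸ Ideal.span {e₁ h'}) :=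
    Ideal.quotientEquiv (Ideal.span {h'}) (Ideal.span {e₁ h'}) e₁
      (by rw [Ideal.map_span, Set.image_singleton, RingEquiv.coe_toRingHom])
  refine ⟨E₀.trans (blowupAlgebra.quotientKerMapQuotientEquiv J₀ (C a) hf hprime' hndvd), fun g => ?_⟩
  rw [RingEquiv.trans_apply]
  change blowupAlgebra.quotientKerMapQuotientEquiv J₀ (C a) hf hprime' hndvd (E₀ (Ideal.Quotient.mk _ (ρ g))) = _
  rw [show E₀ (Ideal.Quotient.mk _ (ρ g)) = Ideal.Quotient.mk _ (e₁ (ρ g)) from Ideal.quotientEquiv_mk _ _ _ _ _,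
    blowupAlgebra.quotientKerMapQuotientEquiv_mk, heρ, blowupAlgebra.mapQuotient_algebraMap]

/-- [OURS · L1 W4.2] **On the `z_i`-chart of the blow-up of a regular local ring along part `z` of a regular system of
parameters, the exceptional equation `z_i` is a prime element** of `R[(z)/z_i]`: the exceptional ideal `(z_i)` is prime
(tree `blowupAlgebra.isPrime_span_algebraMap`, its quotient being `(R/(z))[T_j : j ≠ i]` with `R/(z)` regular, Stacks 0BIQ)
and `z_i` is a non-zero-divisor of the (nontrivial) chart ring. [cite: StacksProject, Tag 0BIQ] -/
theorem prime_algebraMap_blowupAlgebra_of_isRsopPart [IsLocalRing R] {r : ℕ} {z : Fin r → R}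
    (hz : IsRsopPart z) (i : Fin r) :
    Prime (algebraMap R (blowupAlgebra (Ideal.span (Set.range z)) (z i)) (z i)) := by
  haveI := hz.isRegularLocalRing_quotient
  haveI : IsDomain (R ⧸ Ideal.span (Set.range z)) := isDomain_of_isRegularLocalRing _
  have hP := blowupAlgebra.isPrime_span_algebraMap z i hz.isQuasiRegular
  -- the chart ring is nontrivial (its quotient by the exceptional ideal is a domain)
  haveI : Nontrivial (blowupAlgebra (Ideal.span (Set.range z)) (z i)) := by
    by_contra htriv
    rw [not_nontrivial_iff_subsingleton] at htriv
    exact hP.ne_top (Subsingleton.elim _ _)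
  refine (Ideal.span_singleton_prime ?_).mp hP
  exact nonZeroDivisors.ne_zero algebraMap_mem_nonZeroDivisors_blowupAlgebra

/-- [OURS · L1 W4.2] **(P2b), ring level: the `u_{j₀}`-chart of the blow-up of the CP-frame hypersurface `R[X]/(h)` along
`V(X, u_J)` is `R[I_J/u_{j₀}][X']/(h')` with `h'` the monic transform** — `exists_monic_transform` and
`exists_adjoinRoot_ringEquiv_blowupAlgebra` packaged: for `h` monic of degree `m` with `h_{m-i} ∈ I_J^i` (`δ ≥ 1`: the centre is
equimultiple for `h = 0`) and `u_{j₀}` prime in `R[I_J/u_{j₀}]`, there are the monic transform `h'` (same degree, coefficient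
relation (2.7)) and a ring isomorphism `AdjoinRoot h' = R[I_J/u_{j₀}][X']/(h') ≅ (R[X]/(h))[J̄/ū_{j₀}]`, `J = I_J R[X] + (X)`,
compatible with the structure maps. This is the chart in which the transform of a Cossart–Piltant frame `(R, u, h)` under the
blow-up of the permissible centre `V(X, u_J)` is read (minimality of `Δ(h'; u'; X')` at the origin: tree
`CossartPiltant.exists_monic_isMinimal_originChart`, p519647). [cite: CossartPiltant2019, Prop. 2.6 and (2.7) (arXiv v1 pp. 13–14)] -/
theorem exists_monic_transform_ringEquiv {n : ℕ} (u : Fin n → R) {J : Finset (Fin n)} {j₀ : Fin n} {h : R[X]}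
    (hmon : h.Monic)
    (hI : ∀ i ∈ Finset.Icc 1 h.natDegree, h.coeff (h.natDegree - i) ∈ Ideal.span (u '' ↑J) ^ i)
    (hprime : Prime (algebraMap R (blowupAlgebra (Ideal.span (u '' ↑J)) (u j₀)) (u j₀))) :
    ∃ h' : (blowupAlgebra (Ideal.span (u '' ↑J)) (u j₀))[X], h'.Monic ∧ h'.natDegree = h.natDegree ∧
      (∀ i ∈ Finset.Icc 1 h.natDegree, h'.coeff (h.natDegree - i) *
        algebraMap R (blowupAlgebra (Ideal.span (u '' ↑J)) (u j₀)) (u j₀) ^ i =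
          algebraMap R (blowupAlgebra (Ideal.span (u '' ↑J)) (u j₀)) (h.coeff (h.natDegree - i))) ∧
      ∃ e : AdjoinRoot h' ≃+*
          blowupAlgebra (((Ideal.span (u '' ↑J)).map (C : R →+* R[X]) ⊔ Ideal.span {X}).map
            (Ideal.Quotient.mk (Ideal.span {h}))) (Ideal.Quotient.mk (Ideal.span {h}) (C (u j₀))),
        ∀ g : R[X], e (AdjoinRoot.mk h' (eval₂ (C.comp (algebraMap R (blowupAlgebra (Ideal.span (u '' ↑J)) (u j₀))))
            (C (algebraMap R (blowupAlgebra (Ideal.span (u '' ↑J)) (u j₀)) (u j₀)) * X) g)) =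
          algebraMap (R[X] ⧸ Ideal.span {h}) _ (Ideal.Quotient.mk _ g) := by
  haveI : Nontrivial (blowupAlgebra (Ideal.span (u '' ↑J)) (u j₀)) := nontrivial_of_ne _ _ hprime.ne_zero
  obtain ⟨h', hmon', hdeg, hcoef⟩ := exists_monic_transform u (j₀ := j₀) hI
  obtain ⟨e, he⟩ := exists_adjoinRoot_ringEquiv_blowupAlgebra (Ideal.span (u '' ↑J)) (u j₀) hmon hmon' hdeg
    hcoef hprime
  exact ⟨h', hmon', hdeg, hcoef, e, he⟩

end Summit.ResolutionOfSingularities.ResolutionOfSingularities.Theorems.SigmaMaxModificationsCorridor3.Moving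

end
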